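import Literature.AlgebraicGeometry.ShimuraVarieties.UnitaryCurveAuxiliarySymplecticModuleV
import Literature.AlgebraicGeometry.ShimuraVarieties.UnitaryCurveAuxiliarySymplecticAdelic
import HarnessLib

/-!
# The `W₀`-FREE group-map carrier `U(H)(𝔸_f) × T₀(M)(𝔸_f) → GSp_δ(𝔸_{ℚ,f})`, `(a, t) ↦ t·(a ⊗ 1)`, its rational twin and their square
# (RSZ 2020 Remark 3.2 (ii)(iii), (3.3); Deligne 1979 Prop. 2.3.10 ∕ 2.1.2 without the auxiliary line) — any rank `n`

Topic `AlgebraicGeometry/ShimuraVarieties`; namespace `Literature.AlgebraicGeometry.ShimuraVarieties.UnitaryCurve.AuxV`.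
Definitions with bodies and theorems; no named fact, no instance, nothing asserted (net debt 0).  Cell `hodgecm-mathlib` (D-0151), P6 «MOD programme»,
door (E) organ **E1 FILE 2b**: the `V_M`-only twin of ★ `UnitaryCurveAuxiliarySymplecticAdelic` (chart shape of the GEN integrator A-p18 (g31), bus
2026-09-01 21:28:48Z (2): Siegel target `GSp(V_M∣_ℚ, ψ_V)`), over ★ FILE 1b `UnitaryCurveAuxiliarySymplecticModuleV` (`auxRepV`,
`auxRepV_mem_similitudeGroupOfForm`) and the ★ transports `unitaryToTensorFin ∕ torusToTensorFin ∕ unitaryToTensorRat ∕ torusToTensorRat` (reused by name):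

* §1 **`auxToGspFinV F : U(H)(𝔸_f) × T₀(M)(𝔸_f) →* gspFinAdelic δ`**, `(a, t) ↦ auxRepV 𝔸_f F (t′, a′)`; `coe_auxToGspFinV`; the levels
  `auxLevelV F m := K_δ(m).comap (auxToGspFinV F)`, `mem_auxLevelV_iff`, `auxLevelV_anti`.
* §2 **`auxToGspRatV F : U(H)(ℚ) × T₀(M)(ℚ) →* gspRational δ`**, `coe_auxToGspRatV`.
* §3 naturality of `auxRepV` in `R` (`coe_blockGLV_map`, `map_auxRepV`) and **`gspRationalToFinAdelic_auxToGspRatV`**: the square with ★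
  `gspRationalToFinAdelic`, ★ `rationalToFinAdelic`, ★ `toTorusFinAdelic` commutes — what makes the point map `[v, a] ↦ [J_Φ(v)∣_V, ũ(a, t₀)]` of the
  E-line chart well defined on double cosets.

`--supports stmt-HodgeConjecture-24832`, count-neutral; HC_CM is proved only modulo the printed citations until rung 0 closes.

## References
* [RapoportSmithlingZhang2020Diagonal] M. Rapoport, B. Smithling, W. Zhang, Compos. Math. 156 (2020), Remark 3.2 (ii)(iii) pp. 9–10, (3.3).
* [Deligne1979ShimuraVarieties] P. Deligne, *Variétés de Shimura* (1979), Prop. 2.3.10, 2.1.2 (PDF pp. 32, 24 of Milne's translation).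
* [Deligne1971TravauxShimura] P. Deligne, *Travaux de Shimura* (1971), Prop. 1.15 p. 132, 1.8 p. 129, 4.9 p. 147.
* [CasselsFrohlichANT1967] Cassels–Fröhlich, *Algebraic Number Theory*, Ch. II §14 (14.2).
* [Milne2005ShimuraVarieties] J. S. Milne, *Introduction to Shimura varieties* (2005), §5 p. 57.
-/

set_option autoImplicit false

noncomputable section

open Matrix NumberField IsDedekindDomain
open scoped TensorProduct

namespace Literature.AlgebraicGeometry.ShimuraVarieties

namespace UnitaryCurve

namespace AuxV

open Literature.AlgebraicGeometry.ModuliOfAbelianVarieties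
open Literature.AlgebraicGeometry.ShimuraVarieties.UnitaryCanonicalModel.Aux (torusRat torusFinAdelic toTorusFinAdelic coe_toTorusFinAdelic conjAlgHom
  conjAlgHom_apply conjR conjR_tmul ratBasis trace_one_tmul finAdeleToTensor finAdeleToTensor_conjFiniteAdele finAdeleToTensor_algebraMap torusToTensorFin
  torusToTensorFin_cond ratToTensor ratToTensor_complexConj torusToTensorRat torusToTensorRat_cond basis_repr_map resMatrix_map tensorMap_ofId_one_tmul
  ratToTensor_apply)
open Literature.AlgebraicGeometry.ShimuraVarieties.UnitaryCurve.Aux (unitaryToTensorFin unitaryToTensorFin_unitary unitaryToTensorRat unitaryToTensorRat_unitary)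
open Literature.NumberTheory.ComplexMultiplication (ratFiniteAdeleTensorEquiv ratFiniteAdeleTensorEquiv_tmul ratFiniteAdeleTensorEquiv_symm_algebraMap)
open Literature.NumberTheory.Automorphic Literature.NumberTheory.Automorphic.UnitaryGroup

/-! ### §1. The adelic group map `U(H)(𝔸_f) × T₀(M)(𝔸_f) → GSp_δ(𝔸_{ℚ,f})` -/

section Fin

variable {L : Type} [Field L] [NumberField L] [IsCMField L] {M : Type} [Field M] [NumberField M] [IsCMField M]
  {j : L →+* M} {n : ℕ} {H : Matrix (Fin n) (Fin n) L} {ξ : M} {g : ℕ} {δ : Fin g → ℕ}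

/-- **The group-map carrier on finite adèles `(a, t) ↦ t·(a ⊗ 1)` read in the frame: `U(H)(𝔸_f) × T₀(M)(𝔸_f) →* GSp_δ(𝔸_{ℚ,f})`**
(★ `gspFinAdelic δ`), i.e. RSZ's `(z, g) ↦ z·g`. [cite: Deligne1979ShimuraVarieties, Prop. 2.3.10 (PDF p. 32)] [cite: Milne2005ShimuraVarieties, §5 p. 57] -/
def auxToGspFinV (F : SymplecticFrameV M j H ξ g δ) :
    ↥(finAdelic (↥(maximalRealSubfield L)) L (IsCMField.complexConj L) n H) × ↥(torusFinAdelic M) →* ↥(gspFinAdelic δ) :=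
  ((auxRepV (FiniteAdeleRing (𝓞 ℚ) ℚ) F).comp
      (MonoidHom.prod ((torusToTensorFin M).comp (MonoidHom.snd _ _)) ((unitaryToTensorFin M j H).comp (MonoidHom.fst _ _)))).codRestrict
    _ fun p => auxRepV_mem_similitudeGroupOfForm (FiniteAdeleRing (𝓞 ℚ) ℚ) F (torusToTensorFin_cond M p.2)
      (unitaryToTensorFin_unitary M j H p.1)

/-- Underlying element of `auxToGspFinV`. [cite: Deligne1979ShimuraVarieties, Prop. 2.3.10 (PDF p. 32)] -/
theorem coe_auxToGspFinV (F : SymplecticFrameV M j H ξ g δ)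
    (a : ↥(finAdelic (↥(maximalRealSubfield L)) L (IsCMField.complexConj L) n H)) (t : ↥(torusFinAdelic M)) :
    (auxToGspFinV F (a, t) : GL (Fin g ⊕ Fin g) (FiniteAdeleRing (𝓞 ℚ) ℚ)) =
      auxRepV (FiniteAdeleRing (𝓞 ℚ) ℚ) F (torusToTensorFin M t, unitaryToTensorFin M j H a) := rfl

/-- **The auxiliary level `K̃(m) := ũ_β⁻¹(K_δ(m)) ≤ U(H)(𝔸_f) × T₀(M)(𝔸_f)`** (planner delta Δ1 / RECEPTACLE-PLAN §7.2:
the principal pairs `(K̃(m), K_δ(m))` at which the embedding is read; `K̃(m) ∩ (K × L₀)` is the level of the Ext tower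
`T(m)`).  A `Subgroup.comap`; openness and the product decomposition are lemmas for the S2pair prover.
[cite: Deligne1971TravauxShimura, Prop. 1.15 p. 132 («K₂ ⊃ u(K₁)»)] [cite: Deligne1979ShimuraVarieties, 2.1.2 (PDF p. 24)] -/
def auxLevelV (F : SymplecticFrameV M j H ξ g δ) (m : ℕ) :
    Subgroup (↥(finAdelic (↥(maximalRealSubfield L)) L (IsCMField.complexConj L) n H) × ↥(torusFinAdelic M)) :=
  (principalLevelSubgroup δ m).comap (auxToGspFinV F)

/-- Membership in `K̃(m)`: `ũ_β(a, t) ∈ K_δ(m)`. [cite: Deligne1971TravauxShimura, Prop. 1.15 p. 132] -/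
theorem mem_auxLevelV_iff (F : SymplecticFrameV M j H ξ g δ) (m : ℕ)
    (p : ↥(finAdelic (↥(maximalRealSubfield L)) L (IsCMField.complexConj L) n H) × ↥(torusFinAdelic M)) :
    p ∈ auxLevelV F m ↔ auxToGspFinV F p ∈ principalLevelSubgroup δ m :=
  Iff.rfl

/-- `K̃(m′) ≤ K̃(m)` for `m ∣ m′`. [cite: Deligne1971TravauxShimura, 1.8 p. 129] -/
theorem auxLevelV_anti (F : SymplecticFrameV M j H ξ g δ) {m m' : ℕ} (h : m ∣ m') : auxLevelV F m' ≤ auxLevelV F m :=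
  fun p hp => (mem_auxLevelV_iff F m p).2 (principalLevelSubgroup_anti δ h ((mem_auxLevelV_iff F m' p).1 hp))

end Fin

/-! ### §2. The rational group map `U(H)(ℚ) × T₀(M)(ℚ) → GSp_δ(ℚ)` -/

section Rat

variable {L : Type} [Field L] [NumberField L] [IsCMField L] {M : Type} [Field M] [NumberField M] [IsCMField M]
  {j : L →+* M} {n : ℕ} {H : Matrix (Fin n) (Fin n) L} {ξ : M} {g : ℕ} {δ : Fin g → ℕ}

/-- **The group-map carrier on rational points `U(H)(ℚ) × T₀(M)(ℚ) →* GSp_δ(ℚ)`** (★ `gspRational δ`).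
[cite: Deligne1979ShimuraVarieties, Prop. 2.3.10 (PDF p. 32)] [cite: Milne2005ShimuraVarieties, §5 p. 57] -/
def auxToGspRatV (F : SymplecticFrameV M j H ξ g δ) :
    ↥(rational (↥(maximalRealSubfield L)) L (IsCMField.complexConj L) n H) × ↥(torusRat M) →* ↥(gspRational δ) :=
  ((auxRepV ℚ F).comp
      (MonoidHom.prod ((torusToTensorRat M).comp (MonoidHom.snd _ _)) ((unitaryToTensorRat M j H).comp (MonoidHom.fst _ _)))).codRestrict
    _ fun p => auxRepV_mem_similitudeGroupOfForm ℚ F (torusToTensorRat_cond M p.2) (unitaryToTensorRat_unitary M j H p.1)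

/-- Underlying element of `auxToGspRatV`. [cite: Deligne1979ShimuraVarieties, Prop. 2.3.10 (PDF p. 32)] -/
theorem coe_auxToGspRatV (F : SymplecticFrameV M j H ξ g δ)
    (a : ↥(rational (↥(maximalRealSubfield L)) L (IsCMField.complexConj L) n H)) (t : ↥(torusRat M)) :
    (auxToGspRatV F (a, t) : GL (Fin g ⊕ Fin g) ℚ) = auxRepV ℚ F (torusToTensorRat M t, unitaryToTensorRat M j H a) := rfl

end Rat

/-! ### §3. Naturality of `auxRepV` in `R` and the square `ℚ → 𝔸_{ℚ,f}` -/

section Natural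

variable {L : Type} [Field L] (M : Type) [Field M] [NumberField M] [IsCMField M]
  {R R' : Type} [CommRing R] [Algebra ℚ R] [CommRing R'] [Algebra ℚ R'] (φ : R →ₐ[ℚ] R')

omit [NumberField M] [IsCMField M] in
/-- `blockGLV` is natural in the ring. [cite: Deligne1979ShimuraVarieties, Prop. 2.3.10 (PDF p. 32)] -/
theorem coe_blockGLV_map {S S' : Type} [CommRing S] [CommRing S'] (ψ : S →+* S') {n : ℕ} (t : Sˣ) (X : GL (Fin n) S) :
    (((blockGLV S (t, X) : GL (Fin n) S) : Matrix (Fin n) (Fin n) S).map ψ) =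
      ((blockGLV S' (Units.map (ψ : S →* S') t, Matrix.GeneralLinearGroup.map ψ X) : GL (Fin n) S') : Matrix (Fin n) (Fin n) S') := by
  rw [coe_blockGLV, coe_blockGLV]
  ext a b
  simp

variable {M} {j : L →+* M} {n : ℕ} {H : Matrix (Fin n) (Fin n) L} {ξ : M} {g : ℕ} {δ : Fin g → ℕ}

/-- **Naturality of `auxRep` in `R`**: for `φ : R →ₐ[ℚ] R′`, `GL(φ) ∘ auxRep_R = auxRep_{R′} ∘ (φ ⊗ 1)`.
[cite: Deligne1979ShimuraVarieties, Prop. 2.3.10 (PDF p. 32)] [cite: Deligne1971TravauxShimura, 4.9 p. 147] -/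
theorem map_auxRepV (F : SymplecticFrameV M j H ξ g δ) (t : (R ⊗[ℚ] M)ˣ) (X : GL (Fin n) (R ⊗[ℚ] M)) :
    Matrix.GeneralLinearGroup.map (φ : R →+* R') (auxRepV R F (t, X)) =
      auxRepV R' F (Units.map ((Algebra.TensorProduct.map φ (AlgHom.id ℚ M) : R ⊗[ℚ] M →ₐ[ℚ] R' ⊗[ℚ] M) :
          R ⊗[ℚ] M →* R' ⊗[ℚ] M) t,
        Matrix.GeneralLinearGroup.map
          ((Algebra.TensorProduct.map φ (AlgHom.id ℚ M) : R ⊗[ℚ] M →ₐ[ℚ] R' ⊗[ℚ] M) : R ⊗[ℚ] M →+* R' ⊗[ℚ] M) X) := by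
  apply Units.ext
  change (((auxRepV R F (t, X) : GL (Fin g ⊕ Fin g) R) : Matrix (Fin g ⊕ Fin g) (Fin g ⊕ Fin g) R).map φ) = _
  rw [auxRepV, auxRepV, MonoidHom.comp_apply, MonoidHom.comp_apply, MonoidHom.comp_apply, MonoidHom.comp_apply,
    coe_conjRect, coe_conjRect, coe_resGL, coe_resGL, Matrix.map_mul, Matrix.map_mul]
  have hP : (framePVR R F).map φ = framePVR R' F := by
    rw [framePVR, framePVR, Matrix.map_map]; congr 1; funext q; exact φ.commutes q
  have hQ : (frameQVR R F).map φ = frameQVR R' F := by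
    rw [frameQVR, frameQVR, Matrix.map_map]; congr 1; funext q; exact φ.commutes q
  rw [hP, hQ, resMatrix_map M φ]
  congr 1; congr 1; congr 1
  exact coe_blockGLV_map ((Algebra.TensorProduct.map φ (AlgHom.id ℚ M) : R ⊗[ℚ] M →ₐ[ℚ] R' ⊗[ℚ] M) :
    R ⊗[ℚ] M →+* R' ⊗[ℚ] M) t X

end Natural

/-! ### §4. The compatibility square with the diagonal embeddings -/

section Square

variable {L : Type} [Field L] [NumberField L] [IsCMField L] {M : Type} [Field M] [NumberField M] [IsCMField M]
  {j : L →+* M} {n : ℕ} {H : Matrix (Fin n) (Fin n) L} {ξ : M} {g : ℕ} {δ : Fin g → ℕ}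

/-- **The square commutes**: `GSp_δ(ℚ) → GSp_δ(𝔸_f)` ∘ `auxToGspRatV` = `auxToGspFinV` ∘ (`U(H)(ℚ) → U(H)(𝔸_f)` × `T₀(ℚ) → T₀(𝔸_f)`)
(★ `gspRationalToFinAdelic`, ★ `rationalToFinAdelic`, ★ `toTorusFinAdelic`) — the datum needed for the Shimura-set map of
the E-line chart to be well defined on double cosets. [cite: Deligne1979ShimuraVarieties, 2.1.2 (PDF p. 24)] [cite: Milne2005ShimuraVarieties, §5 p. 57] -/
theorem gspRationalToFinAdelic_auxToGspRatV (F : SymplecticFrameV M j H ξ g δ)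
    (a : ↥(rational (↥(maximalRealSubfield L)) L (IsCMField.complexConj L) n H)) (t : ↥(torusRat M)) :
    gspRationalToFinAdelic δ (auxToGspRatV F (a, t)) =
      auxToGspFinV F (rationalToFinAdelic (↥(maximalRealSubfield L)) L (IsCMField.complexConj L) n H a,
        toTorusFinAdelic M t) := by
  apply Subtype.ext
  rw [coe_gspRationalToFinAdelic, coe_auxToGspRatV, coe_auxToGspFinV]
  have h := map_auxRepV (Algebra.ofId ℚ (FiniteAdeleRing (𝓞 ℚ) ℚ)) F (torusToTensorRat M t) (unitaryToTensorRat M j H a)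
  have hφ : ((Algebra.ofId ℚ (FiniteAdeleRing (𝓞 ℚ) ℚ) : ℚ →ₐ[ℚ] FiniteAdeleRing (𝓞 ℚ) ℚ) : ℚ →+* _) =
      algebraMap ℚ (FiniteAdeleRing (𝓞 ℚ) ℚ) := rfl
  rw [hφ] at h
  rw [h]
  congr 2
  · apply Units.ext
    change Algebra.TensorProduct.map _ _ ((1 : ℚ) ⊗ₜ ((t : Mˣ) : M)) = (ratFiniteAdeleTensorEquiv M).symm _
    rw [tensorMap_ofId_one_tmul, Subgroup.subtype_apply, coe_toTorusFinAdelic, FiniteAdeleRing.unitEmbedding_apply]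
  · apply Units.ext
    ext i k
    change Algebra.TensorProduct.map _ _ ((1 : ℚ) ⊗ₜ j (((a : GL (Fin n) L) : Matrix (Fin n) (Fin n) L) i k)) =
      finAdeleToTensor M j ((((rationalToFinAdelic (↥(maximalRealSubfield L)) L (IsCMField.complexConj L) n H a :
        finAdelic _ L _ n H) : GL (Fin n) (FiniteAdeleRing (𝓞 L) L)) : Matrix (Fin n) (Fin n) _) i k)
    rw [coe_rationalToFinAdelic]
    change _ = finAdeleToTensor M j (algebraMap L (FiniteAdeleRing (𝓞 L) L) (((a : GL (Fin n) L) : Matrix (Fin n) (Fin n) L) i k))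
    rw [finAdeleToTensor_algebraMap, Algebra.TensorProduct.map_tmul, map_one, AlgHom.id_apply]

end Square

end AuxV

end UnitaryCurve

end Literature.AlgebraicGeometry.ShimuraVarieties

end
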